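import Mathlib.Analysis.InnerProductSpace.PiL2
import Mathlib.LinearAlgebra.UnitaryGroup
import HarnessLib

/-!
# State vectors in `ℂ^X`: the `ℓ₂` norm, normalisation, unitaries and measurement statistics

Topic `Computability/QuantumComplexity`. Elementary facts about pure states `f : X → ℂ` on a finite
index set `X` used to turn closeness of (unnormalised) state vectors into closeness of measurement
statistics (Bernstein–Vazirani 1997, Thm. 3.1 / Lemma 3.6: "if two unit-length superpositions are
within Euclidean distance `ε` then the total variation distance between the probability
distributions resulting from measurements of the two superpositions is at most `4ε`"; Nielsen–Chuang
2010, §2.2.5, Box 4.1). Everything here is PROVED: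

* `QState.l2 f = ‖f‖₂ = √(∑ |f x|²)` (the Euclidean norm of `ℂ^X`), triangle inequality,
  homogeneity; `QState.normalize f = f/‖f‖₂`;
* `QState.l2_normalize_sub_normalize_le` — **relative closeness passes to normalised states**:
  `‖f − g‖₂ ≤ δ‖f‖₂ ⟹ ‖f̂ − ĝ‖₂ ≤ 2δ`;
* `QState.l2_unitary_mulVec` — unitary matrices preserve `‖·‖₂`;
* `QState.sum_abs_normSq_sub_le`, `QState.abs_sum_filter_normSq_sub_le` — **measurement**:
  `∑ₓ | |f x|² − |g x|² | ≤ 2‖f − g‖₂` for unit vectors, hence every event has probabilities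
  within `2‖f − g‖₂` under the two states.

These are the generic steps of the analysis of Regev's quantum step (Regev 2009, Lemma 3.14,
"this state is exponentially close to the required state … the QFT … measuring").

## References

* E. Bernstein, U. Vazirani, *Quantum complexity theory*, SIAM J. Comput. 26 (1997), Lemma 3.6 /
  Thm. 3.1 (proof) [BennettBernsteinBrassardVazirani1997].
* M. A. Nielsen, I. L. Chuang, *Quantum Computation and Quantum Information*, CUP 2010, §2.2.5
  [NielsenChuang2010].
-/

noncomputable section

open Complex Matrix
open scoped Real ComplexConjugate

namespace Literature.Computability.QuantumComplexity

namespace QState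

variable {X : Type*} [Fintype X]

/-- The `ℓ₂` norm of a state vector `f : X → ℂ` (the Euclidean norm of `ℂ^X`). [folklore] -/
def l2 (f : X → ℂ) : ℝ := ‖(WithLp.toLp 2 f : EuclideanSpace ℂ X)‖

/-- `‖f‖₂ = √(∑ |f x|²)`. [folklore] -/
theorem l2_eq_sqrt (f : X → ℂ) : l2 f = Real.sqrt (∑ x, ‖f x‖ ^ 2) := by
  rw [l2, EuclideanSpace.norm_eq]

/-- `‖f‖₂ ≥ 0`. [folklore] -/
theorem l2_nonneg (f : X → ℂ) : 0 ≤ l2 f := norm_nonneg _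

/-- `‖f‖₂² = ∑ |f x|²`. [folklore] -/
theorem l2_sq (f : X → ℂ) : l2 f ^ 2 = ∑ x, ‖f x‖ ^ 2 := by
  rw [l2_eq_sqrt, Real.sq_sqrt (Finset.sum_nonneg fun _ _ => by positivity)]

/-- Triangle inequality. [folklore] -/
theorem l2_sub_le (f g h : X → ℂ) : l2 (f - h) ≤ l2 (f - g) + l2 (g - h) := by
  unfold l2
  simpa [WithLp.toLp_sub] using norm_sub_le_norm_sub_add_norm_sub (WithLp.toLp 2 f : EuclideanSpace ℂ X)
    (WithLp.toLp 2 g) (WithLp.toLp 2 h)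

/-- `‖f - g‖₂ = ‖g - f‖₂`. [folklore] -/
theorem l2_sub_comm (f g : X → ℂ) : l2 (f - g) = l2 (g - f) := by
  unfold l2
  rw [WithLp.toLp_sub, WithLp.toLp_sub, norm_sub_rev]

/-- Real homogeneity. [folklore] -/
theorem l2_smul (c : ℝ) (f : X → ℂ) : l2 (c • f) = |c| * l2 f := by
  unfold l2
  rw [WithLp.toLp_smul, norm_smul, Real.norm_eq_abs]

/-- Complex homogeneity. [folklore] -/
theorem l2_const_mul (c : ℂ) (f : X → ℂ) : l2 (fun x => c * f x) = ‖c‖ * l2 f := by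
  unfold l2
  rw [show (fun x => c * f x) = c • f from rfl, WithLp.toLp_smul, norm_smul]

/-- `‖f‖₂ = 0 ↔ f = 0`. [folklore] -/
theorem l2_eq_zero_iff (f : X → ℂ) : l2 f = 0 ↔ f = 0 := by
  unfold l2
  rw [norm_eq_zero]
  constructor
  · intro h; exact (WithLp.toLp_eq_zero 2).1 h
  · intro h; rw [h, WithLp.toLp_zero]

/-- `f ≠ 0 → 0 < ‖f‖₂`. [folklore] -/
theorem l2_pos {f : X → ℂ} (hf : f ≠ 0) : 0 < l2 f :=
  lt_of_le_of_ne (l2_nonneg f) fun h => hf ((l2_eq_zero_iff f).1 h.symm)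

/-! ### Normalisation -/

/-- **The normalised state `f/‖f‖₂`** (and `0 ↦ 0`). [folklore] -/
def normalize (f : X → ℂ) : X → ℂ := (l2 f)⁻¹ • f

/-- `‖f̂‖₂ = 1` for `f ≠ 0`. [folklore] -/
theorem l2_normalize {f : X → ℂ} (hf : f ≠ 0) : l2 (normalize f) = 1 := by
  rw [normalize, l2_smul, abs_of_pos (inv_pos.2 (l2_pos hf)), inv_mul_cancel₀ (l2_pos hf).ne']

/-- Normalisation ignores positive constants. [folklore] -/
theorem normalize_smul {c : ℝ} (hc : 0 < c) (f : X → ℂ) : normalize (c • f) = normalize f := by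
  rw [normalize, normalize, l2_smul, abs_of_pos hc, smul_smul, mul_inv]
  congr 1
  field_simp

/-- Normalisation ignores positive constants (pointwise-multiplication form). [folklore] -/
theorem normalize_const_mul {c : ℝ} (hc : 0 < c) (f : X → ℂ) :
    normalize (fun x => (c : ℂ) * f x) = normalize f := by
  rw [show (fun x => (c : ℂ) * f x) = c • f from funext fun x => by simp [Complex.real_smul], normalize_smul hc]

/-- **Relative closeness passes to normalised states**: if `‖f - g‖₂ ≤ δ‖f‖₂` (`f ≠ 0`) then
`‖f̂ - ĝ‖₂ ≤ 2δ`. [folklore] -/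
theorem l2_normalize_sub_normalize_le {f g : X → ℂ} (hf : f ≠ 0) {δ : ℝ} (h : l2 (f - g) ≤ δ * l2 f) :
    l2 (normalize f - normalize g) ≤ 2 * δ := by
  have hfpos := l2_pos hf
  have hδ : 0 ≤ δ := by
    have := (l2_nonneg (f - g)).trans h
    exact nonneg_of_mul_nonneg_left this hfpos |> fun h => h
  -- first step: `‖f/‖f‖ - g/‖f‖‖ = ‖f - g‖/‖f‖ ≤ δ`
  have h1 : l2 (normalize f - (l2 f)⁻¹ • g) ≤ δ := by
    rw [normalize, ← smul_sub, l2_smul, abs_of_pos (inv_pos.2 hfpos), inv_mul_le_iff₀ hfpos]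
    linarith
  -- second step: `‖g/‖f‖ - g/‖g‖‖ = |‖g‖ - ‖f‖|/‖f‖ ≤ ‖f - g‖/‖f‖ ≤ δ`
  have h2 : l2 ((l2 f)⁻¹ • g - normalize g) ≤ δ := by
    by_cases hg : g = 0
    · simp only [hg, smul_zero, normalize, sub_self]
      rw [show (0 : X → ℂ) = (0 : ℝ) • (0 : X → ℂ) by simp, l2_smul]; simp [hδ]
    have hgpos := l2_pos hg
    rw [normalize, ← sub_smul, l2_smul]
    have hnorm : |l2 g - l2 f| ≤ l2 (f - g) := by
      have h3 := l2_sub_le f g 0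
      have h4 := l2_sub_le g f 0
      simp only [sub_zero] at h3 h4
      rw [l2_sub_comm g f] at h4
      rw [abs_le]; constructor <;> linarith
    calc |(l2 f)⁻¹ - (l2 g)⁻¹| * l2 g = |l2 g - l2 f| / l2 f := by
          rw [inv_sub_inv hfpos.ne' hgpos.ne', abs_div, abs_of_pos (mul_pos hfpos hgpos)]
          field_simp
      _ ≤ l2 (f - g) / l2 f := div_le_div_of_nonneg_right hnorm hfpos.le
      _ ≤ δ := by rw [div_le_iff₀ hfpos]; exact h
  calc l2 (normalize f - normalize g)
      ≤ l2 (normalize f - (l2 f)⁻¹ • g) + l2 ((l2 f)⁻¹ • g - normalize g) := l2_sub_le _ _ _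
    _ ≤ δ + δ := add_le_add h1 h2
    _ = 2 * δ := by ring

/-! ### Unitaries preserve the norm -/

/-- **A unitary matrix preserves `‖·‖₂`** (`∑_t |(Uf)_t|² = ∑_{s,s'} f_s conj(f_{s'}) (U^*U)_{s's}`).
[folklore] -/
theorem l2_unitary_mulVec [DecidableEq X] {U : Matrix X X ℂ} (hU : U ∈ Matrix.unitaryGroup X ℂ) (f : X → ℂ) :
    l2 (U *ᵥ f) = l2 f := by
  have hU' : star U * U = 1 := Matrix.mem_unitaryGroup_iff'.1 hU
  have key : ∑ t, ‖(U *ᵥ f) t‖ ^ 2 = ∑ s, ‖f s‖ ^ 2 := by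
    -- work in `ℂ`
    have hC : (∑ t, ((‖(U *ᵥ f) t‖ ^ 2 : ℝ) : ℂ)) = ∑ s, ((‖f s‖ ^ 2 : ℝ) : ℂ) := by
      have hsq : ∀ z : ℂ, ((‖z‖ ^ 2 : ℝ) : ℂ) = z * conj z := fun z => by
        rw [Complex.mul_conj, Complex.normSq_eq_norm_sq, Complex.ofReal_pow]
      simp_rw [hsq]
      calc ∑ t, (U *ᵥ f) t * conj ((U *ᵥ f) t)
          = ∑ t, ∑ s, ∑ s', (U t s * f s) * conj (U t s' * f s') := by
            refine Finset.sum_congr rfl fun t _ => ?_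
            rw [Matrix.mulVec, dotProduct, map_sum, Finset.sum_mul_sum]
        _ = ∑ s, ∑ s', f s * conj (f s') * ∑ t, conj (U t s') * U t s := by
            rw [Finset.sum_comm]
            refine Finset.sum_congr rfl fun s _ => ?_
            rw [Finset.sum_comm]
            refine Finset.sum_congr rfl fun s' _ => ?_
            rw [Finset.mul_sum]
            refine Finset.sum_congr rfl fun t _ => ?_
            rw [map_mul]; ring
        _ = ∑ s, ∑ s', f s * conj (f s') * (star U * U) s' s := by
            refine Finset.sum_congr rfl fun s _ => Finset.sum_congr rfl fun s' _ => ?_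
            rw [Matrix.mul_apply]
            rfl
        _ = ∑ s, f s * conj (f s) := by
            refine Finset.sum_congr rfl fun s _ => ?_
            rw [hU', Finset.sum_eq_single s]
            · rw [Matrix.one_apply_eq, mul_one]
            · intro s' _ hs'
              rw [Matrix.one_apply_ne hs', mul_zero]
            · intro h; exact absurd (Finset.mem_univ s) h
    exact_mod_cast hC
  rw [l2_eq_sqrt, l2_eq_sqrt, key]

/-! ### Measurement statistics of close states -/

/-- Cauchy–Schwarz in the form `∑ a_x b_x ≤ √(∑ a_x²) √(∑ b_x²)`. [folklore] -/
theorem sum_mul_le_sqrt_mul_sqrt' (a b : X → ℝ) :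
    ∑ x, a x * b x ≤ Real.sqrt (∑ x, a x ^ 2) * Real.sqrt (∑ x, b x ^ 2) := by
  have h := Finset.sum_mul_sq_le_sq_mul_sq Finset.univ a b
  have ha : 0 ≤ ∑ x, a x ^ 2 := Finset.sum_nonneg fun _ _ => sq_nonneg _
  rw [← Real.sqrt_mul ha]
  exact (le_abs_self _).trans (Real.abs_le_sqrt h)

/-- **`∑ₓ | |f x|² − |g x|² | ≤ 2‖f − g‖₂` for unit vectors** (so the measurement statistics of
close states are close). [cite: BennettBernsteinBrassardVazirani1997, Thm. 3.1 (proof)] -/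
theorem sum_abs_normSq_sub_le {f g : X → ℂ} (hf : l2 f = 1) (hg : l2 g = 1) :
    ∑ x, |‖f x‖ ^ 2 - ‖g x‖ ^ 2| ≤ 2 * l2 (f - g) := by
  have hterm : ∀ x, |‖f x‖ ^ 2 - ‖g x‖ ^ 2| ≤ ‖f x - g x‖ * ‖f x‖ + ‖f x - g x‖ * ‖g x‖ := by
    intro x
    rw [sq_sub_sq, abs_mul, abs_of_nonneg (by positivity : 0 ≤ ‖f x‖ + ‖g x‖)]
    have h : |‖f x‖ - ‖g x‖| ≤ ‖f x - g x‖ := abs_norm_sub_norm_le _ _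
    nlinarith [norm_nonneg (f x), norm_nonneg (g x), abs_nonneg (‖f x‖ - ‖g x‖)]
  have hfg : Real.sqrt (∑ x, ‖f x - g x‖ ^ 2) = l2 (f - g) := by rw [l2_eq_sqrt]; rfl
  have hA : ∑ x, ‖f x - g x‖ * ‖f x‖ ≤ l2 (f - g) := by
    refine (sum_mul_le_sqrt_mul_sqrt' _ _).trans (le_of_eq ?_)
    rw [hfg, ← l2_eq_sqrt, hf, mul_one]
  have hB : ∑ x, ‖f x - g x‖ * ‖g x‖ ≤ l2 (f - g) := by
    refine (sum_mul_le_sqrt_mul_sqrt' _ _).trans (le_of_eq ?_)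
    rw [hfg, ← l2_eq_sqrt, hg, mul_one]
  calc ∑ x, |‖f x‖ ^ 2 - ‖g x‖ ^ 2|
      ≤ ∑ x, (‖f x - g x‖ * ‖f x‖ + ‖f x - g x‖ * ‖g x‖) := Finset.sum_le_sum fun x _ => hterm x
    _ = ∑ x, ‖f x - g x‖ * ‖f x‖ + ∑ x, ‖f x - g x‖ * ‖g x‖ := Finset.sum_add_distrib
    _ ≤ l2 (f - g) + l2 (f - g) := add_le_add hA hB
    _ = 2 * l2 (f - g) := by ring

/-- **Events have close probabilities under close states**: for unit vectors and any event `P`,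
`|∑_{P x} |f x|² − ∑_{P x} |g x|²| ≤ 2‖f − g‖₂`. [cite: BennettBernsteinBrassardVazirani1997, Thm. 3.1 (proof)] -/
theorem abs_sum_filter_normSq_sub_le {f g : X → ℂ} (hf : l2 f = 1) (hg : l2 g = 1) (P : X → Prop)
    [DecidablePred P] :
    |∑ x ∈ Finset.univ.filter P, ‖f x‖ ^ 2 - ∑ x ∈ Finset.univ.filter P, ‖g x‖ ^ 2| ≤ 2 * l2 (f - g) := by
  rw [← Finset.sum_sub_distrib]
  refine (Finset.abs_sum_le_sum_abs _ _).trans ?_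
  exact (Finset.sum_le_sum_of_subset_of_nonneg (Finset.filter_subset _ _) (fun _ _ _ => abs_nonneg _)).trans
    (sum_abs_normSq_sub_le hf hg)

/-- The measurement law of a unit vector has total mass `1`. [folklore] -/
theorem sum_normSq_eq_one {f : X → ℂ} (hf : l2 f = 1) : ∑ x, ‖f x‖ ^ 2 = 1 := by
  rw [← l2_sq, hf, one_pow]

end QState

end Literature.Computability.QuantumComplexity

end
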